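import Mathlib

/-!
# Smyth's theorem: the real-arithmetic endgames (venture `DiscreteObjects`, target L)

Cell `pub-namedobj`, seat `pub-namedobj-mahler` (gen 8). Framing: lottery ticket; floor = certified
bounds/negative ranges.

Pure inequalities between finitely many real numbers (Taylor coefficients of the Blaschke quotients
`f, g` of a nonreciprocal integer polynomial, `c = f(0) = g(0) = 1/M(P)`), extracted from
[McKee–Smyth, *Around the Unit Circle*, §12.2.1–12.2.3]; no analysis here.

* `quad_forall_nonpos` — a concave quadratic `Aγ² + Bγ + C ≤ 0` for all `γ` has `B² - 4AC ≤ 0`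
  (and `B = 0` if `A = 0`);
* `smyth_orderK` — (12.10)/(12.11): from `f_k = g_k + a c`, `|f_k|, |g_k| ≤ 1 - c²`, `c ≥ 3/4`:
  `a = ±1`, `|f_k| + |g_k| = c`, `c/2 ≤ 1 - c²`;
* `smyth_b_bound` — `|a_ℓ| = 1` (the step after (12.11));
* `smyth_caseA_arith` — §12.2.2: the family of Parseval inequalities
  `5c²/4 + (x+γc)² + (c/2 + x/2 - γc/2 + βc)² ≤ 2 + γ² + β²` (all real `β, γ`) forces `c² + c³ ≤ 1`
  (via `40c⁴ - 93c² + 40 ≥ 0`; the degenerate case `4c⁴ - 9c² + 4 = 0` is handled by `|x| ≤ 1 - c²`);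
* `smyth_caseB_arith` — §12.2.3, (12.18) ⟹ `1 - c² - c³ ≥ 0`.
The conclusion `c² + c³ ≤ 1` is `M³ ≥ M + 1`, i.e. `M ≥ θ₀`, for `M = 1/c`.
-/

namespace Summit.Ventures.DiscreteObjects.Mahler

/-- A quadratic `Aγ² + Bγ + C` with `A ≤ 0` which is `≤ 0` for every real `γ` has nonpositive
discriminant `B² - 4AC ≤ 0`, and `B = 0` when `A = 0`. -/
theorem quad_forall_nonpos {A B C : ℝ} (hA : A ≤ 0) (h : ∀ γ : ℝ, A * γ ^ 2 + B * γ + C ≤ 0) :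
    B ^ 2 - 4 * A * C ≤ 0 ∧ (A = 0 → B = 0) := by
  have hB0 : A = 0 → B = 0 := by
    intro hA0
    by_contra hB
    have h1 := h ((1 - C) / B)
    rw [hA0] at h1
    have : B * ((1 - C) / B) = 1 - C := by field_simp
    linarith
  refine ⟨?_, hB0⟩
  rcases lt_or_eq_of_le hA with hAlt | hAeq
  · have h1 := h (-B / (2 * A))
    have hA0 : A ≠ 0 := ne_of_lt hAlt
    have key : A * (-B / (2 * A)) ^ 2 + B * (-B / (2 * A)) + C = (4 * A * C - B ^ 2) / (4 * A) := by
      field_simp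
      ring
    rw [key, div_le_iff_of_neg (by linarith)] at h1
    linarith
  · have hB : B = 0 := hB0 hAeq
    rw [hB, hAeq]; simp

/-- **(12.10)–(12.11).**  If `f_k = g_k + a c` with an integer `a ≠ 0`, `|f_k|, |g_k| ≤ 1 - c²` and
`3/4 ≤ c`, then `a = ±1`, `|f_k| + |g_k| = c` and `c/2 ≤ 1 - c²`. -/
theorem smyth_orderK {c Fk Gk : ℝ} {a : ℤ} (hc : 3 / 4 ≤ c) (hF : |Fk| ≤ 1 - c ^ 2)
    (hG : |Gk| ≤ 1 - c ^ 2) (ha : a ≠ 0) (hrel : Fk = Gk + a * c) :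
    (a = 1 ∨ a = -1) ∧ |Fk| + |Gk| = c ∧ c / 2 ≤ 1 - c ^ 2 := by
  have hFG : |Fk - Gk| ≤ 2 * (1 - c ^ 2) := by
    calc |Fk - Gk| ≤ |Fk| + |Gk| := abs_sub _ _
      _ ≤ _ := by linarith
  have hdiff : Fk - Gk = a * c := by linarith
  rw [hdiff, abs_mul, abs_of_pos (by linarith : (0 : ℝ) < c)] at hFG
  have hsmall : 1 - c ^ 2 < c := by nlinarith
  -- `|a| < 2`
  have ha2 : |(a : ℝ)| < 2 := by
    by_contra hge
    push Not at hge
    have : 2 * c ≤ |(a : ℝ)| * c := by nlinarith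
    nlinarith
  have ha1 : a = 1 ∨ a = -1 := by
    have : |a| < 2 := by
      have h' : ((|a| : ℤ) : ℝ) < 2 := by rw [Int.cast_abs]; exact ha2
      exact_mod_cast h'
    rcases abs_lt.mp this with ⟨h1, h2⟩
    omega
  refine ⟨ha1, ?_, ?_⟩
  · rcases ha1 with h1 | h1
    · rw [h1] at hrel; push_cast at hrel
      have hGneg : Gk ≤ 0 := by
        have := (abs_le.mp hF).2; linarith
      have hFpos : 0 ≤ Fk := by
        have := (abs_le.mp hG).1; linarith
      rw [abs_of_nonneg hFpos, abs_of_nonpos hGneg]; linarith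
    · rw [h1] at hrel; push_cast at hrel
      have hFneg : Fk ≤ 0 := by
        have := (abs_le.mp hG).2; linarith
      have hGpos : 0 ≤ Gk := by
        have := (abs_le.mp hF).1; linarith
      rw [abs_of_nonpos hFneg, abs_of_nonneg hGpos]; linarith
  · have h1 : (1 : ℝ) ≤ |(a : ℝ)| := by
      rcases ha1 with h | h <;> rw [h] <;> simp
    nlinarith

/-- **`|a_ℓ| = 1`.**  If `f_ℓ = g_ℓ + a g_{ℓ-k} + b c` with `a = ±1`, an integer `b ≠ 0`, all three
coefficients bounded by `1 - c²` and `c ≥ 3/4`, then `b = ±1`. -/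
theorem smyth_b_bound {c Fl Gl Glk : ℝ} {a b : ℤ} (hc : 3 / 4 ≤ c) (ha : a = 1 ∨ a = -1)
    (hFl : |Fl| ≤ 1 - c ^ 2) (hGl : |Gl| ≤ 1 - c ^ 2) (hGlk : |Glk| ≤ 1 - c ^ 2)
    (hb : b ≠ 0) (hrel : Fl = Gl + a * Glk + b * c) : b = 1 ∨ b = -1 := by
  have habs : |(a : ℝ) * Glk| ≤ 1 - c ^ 2 := by
    rw [abs_mul]
    rcases ha with h | h <;> rw [h] <;> simp [hGlk]
  have hbc : |(b : ℝ)| * c ≤ 3 * (1 - c ^ 2) := by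
    have e : (b : ℝ) * c = Fl - Gl - a * Glk := by linarith
    have : |(b : ℝ) * c| ≤ |Fl| + |Gl| + |(a : ℝ) * Glk| := by
      rw [e]
      calc |Fl - Gl - a * Glk| ≤ |Fl - Gl| + |(a : ℝ) * Glk| := abs_sub _ _
        _ ≤ |Fl| + |Gl| + |(a : ℝ) * Glk| := by linarith [abs_sub Fl Gl]
    rw [abs_mul, abs_of_pos (by linarith : (0 : ℝ) < c)] at this
    linarith
  have hb2 : |(b : ℝ)| < 2 := by
    by_contra hge
    push Not at hge
    have : 2 * c ≤ |(b : ℝ)| * c := by nlinarith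
    nlinarith
  have : |b| < 2 := by
    have h' : ((|b| : ℤ) : ℝ) < 2 := by rw [Int.cast_abs]; exact hb2
    exact_mod_cast h'
  rcases abs_lt.mp this with ⟨h1, h2⟩
  omega

/-- **§12.2.2 endgame.**  If `3/4 ≤ c`, `c/2 ≤ 1 - c²`, `|x| ≤ 1 - c²` and, for all real `β, γ`,
`5c²/4 + (x + γc)² + (c/2 + x/2 - γc/2 + βc)² ≤ 2 + γ² + β²`, then `c² + c³ ≤ 1`. -/
theorem smyth_caseA_arith {c x : ℝ} (hc : 3 / 4 ≤ c) (hc2 : c / 2 ≤ 1 - c ^ 2) (hx : |x| ≤ 1 - c ^ 2)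
    (h : ∀ β γ : ℝ, 5 * c ^ 2 / 4 + (x + γ * c) ^ 2 + (c / 2 + x / 2 - γ * c / 2 + β * c) ^ 2 ≤
      2 + γ ^ 2 + β ^ 2) : c ^ 2 + c ^ 3 ≤ 1 := by
  have hc78 : c ≤ 781 / 1000 := by nlinarith
  have h1c : 0 < 1 - c ^ 2 := by nlinarith
  obtain ⟨hxlo, hxhi⟩ := abs_le.mp hx
  -- the quadratic in `γ` obtained by optimising `β`
  set D2 : ℝ := 4 * c ^ 4 - 9 * c ^ 2 + 4 with hD2def
  set B : ℝ := 2 * c * (x * (3 - 4 * c ^ 2) - c) with hBdef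
  set C0 : ℝ := 4 * (1 - c ^ 2) * (5 * c ^ 2 / 4 - 2) + 4 * (1 - c ^ 2) * x ^ 2 + (c + x) ^ 2 with hC0def
  have hD2nn : 0 ≤ D2 := by
    have e : D2 = (2 * c ^ 2 + c - 2) * (2 * c ^ 2 - c - 2) := by rw [hD2def]; ring
    rw [e]
    apply mul_nonneg_of_nonpos_of_nonpos <;> nlinarith
  have hquad : ∀ γ : ℝ, (-D2) * γ ^ 2 + B * γ + C0 ≤ 0 := by
    intro γ
    set K : ℝ := (c + x - γ * c) / 2 with hK
    have hh := h (K * c / (1 - c ^ 2)) γ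
    have iden : 4 * (1 - c ^ 2) * (5 * c ^ 2 / 4 + (x + γ * c) ^ 2 +
        (c / 2 + x / 2 - γ * c / 2 + K * c / (1 - c ^ 2) * c) ^ 2 - (2 + γ ^ 2 + (K * c / (1 - c ^ 2)) ^ 2))
        = (-D2) * γ ^ 2 + B * γ + C0 := by
      rw [hD2def, hBdef, hC0def, hK]
      field_simp
      ring
    have : 4 * (1 - c ^ 2) * (5 * c ^ 2 / 4 + (x + γ * c) ^ 2 +
        (c / 2 + x / 2 - γ * c / 2 + K * c / (1 - c ^ 2) * c) ^ 2 - (2 + γ ^ 2 + (K * c / (1 - c ^ 2)) ^ 2))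
        ≤ 0 := by
      apply mul_nonpos_of_nonneg_of_nonpos (by linarith) (by linarith)
    linarith
  obtain ⟨hdisc, hdeg⟩ := quad_forall_nonpos (by linarith) hquad
  -- `Φ = B² + 4·D2·C0 ≤ 0`
  have hΦ : B ^ 2 + 4 * D2 * C0 ≤ 0 := by linarith
  by_cases hD : D2 = 0
  · -- degenerate case: `B = 0`, i.e. `x (3 - 4c²) = c`, impossible for `|x| ≤ 1 - c²`
    exfalso
    have hB : B = 0 := hdeg (by linarith)
    have hcx : x * (3 - 4 * c ^ 2) = c := by
      have : 2 * c * (x * (3 - 4 * c ^ 2) - c) = 0 := by rw [hBdef] at hB; exact hB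
      have hc0 : (2 * c) ≠ 0 := by linarith
      have := (mul_eq_zero.mp this).resolve_left hc0
      linarith
    nlinarith
  · have hDpos : 0 < D2 := lt_of_le_of_ne hD2nn (Ne.symm hD)
    have hα : 0 < 16 * (1 - c ^ 2) * (5 - 8 * c ^ 2) := by
      have : 0 < 5 - 8 * c ^ 2 := by nlinarith
      positivity
    -- `4αΦ = (2αx + β₁)² - 256·L·D2·(1-c²)²`
    have iden2 : 4 * (16 * (1 - c ^ 2) * (5 - 8 * c ^ 2)) * (B ^ 2 + 4 * D2 * C0) =
        (2 * (16 * (1 - c ^ 2) * (5 - 8 * c ^ 2)) * x + (64 * c ^ 5 - 96 * c ^ 3 + 32 * c)) ^ 2 -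
          256 * (40 * c ^ 4 - 93 * c ^ 2 + 40) * D2 * (1 - c ^ 2) ^ 2 := by
      rw [hBdef, hC0def, hD2def]; ring
    have hL : 0 ≤ 40 * c ^ 4 - 93 * c ^ 2 + 40 := by
      have h1 : 4 * (16 * (1 - c ^ 2) * (5 - 8 * c ^ 2)) * (B ^ 2 + 4 * D2 * C0) ≤ 0 :=
        mul_nonpos_of_nonneg_of_nonpos (by positivity) hΦ
      have h2 : 0 ≤ (2 * (16 * (1 - c ^ 2) * (5 - 8 * c ^ 2)) * x + (64 * c ^ 5 - 96 * c ^ 3 + 32 * c)) ^ 2 :=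
        sq_nonneg _
      have h3 : 256 * (40 * c ^ 4 - 93 * c ^ 2 + 40) * D2 * (1 - c ^ 2) ^ 2 ≥ 0 := by linarith
      have h4 : 0 < 256 * D2 * (1 - c ^ 2) ^ 2 := by positivity
      by_contra hneg
      push Not at hneg
      have : 256 * (40 * c ^ 4 - 93 * c ^ 2 + 40) * D2 * (1 - c ^ 2) ^ 2 < 0 := by
        have : 256 * (40 * c ^ 4 - 93 * c ^ 2 + 40) * D2 * (1 - c ^ 2) ^ 2 =
            (40 * c ^ 4 - 93 * c ^ 2 + 40) * (256 * D2 * (1 - c ^ 2) ^ 2) := by ring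
        rw [this]; exact mul_neg_of_neg_of_pos hneg h4
      linarith
    -- from `40c⁴ - 93c² + 40 ≥ 0` and `3/4 ≤ c ≤ 0.781`: `c² ≤ 0.5698`, hence `c² + c³ ≤ 1`
    have hu : c ^ 2 ≤ 5698 / 10000 := by
      by_contra hgt
      push Not at hgt
      have hu2 : c ^ 2 ≤ 62 / 100 := by nlinarith
      nlinarith
    have hc1 : c ≤ 75486 / 100000 := by nlinarith
    nlinarith

/-- **§12.2.3 endgame (12.18).**  If `3/4 ≤ c < 1`, `x ≤ 1 - c²` and
`c - x ≤ 2(1-c²) - x²/(1+c) - (c-x)²/(1-c)`, then `c² + c³ ≤ 1`. -/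
theorem smyth_caseB_arith {c x : ℝ} (hc : 3 / 4 ≤ c) (hc1 : c < 1) (hx : x ≤ 1 - c ^ 2)
    (h : c - x ≤ 2 * (1 - c ^ 2) - x ^ 2 / (1 + c) - (c - x) ^ 2 / (1 - c)) : c ^ 2 + c ^ 3 ≤ 1 := by
  have h1 : 0 < 1 - c := by linarith
  have h2 : 0 < 1 + c := by linarith
  have key : (c - x) * ((1 - c) * (1 + c)) ≤
      2 * (1 - c ^ 2) ^ 2 - x ^ 2 * (1 - c) - (c - x) ^ 2 * (1 + c) := by
    have e : 2 * (1 - c ^ 2) - x ^ 2 / (1 + c) - (c - x) ^ 2 / (1 - c) =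
        (2 * (1 - c ^ 2) ^ 2 - x ^ 2 * (1 - c) - (c - x) ^ 2 * (1 + c)) / ((1 - c) * (1 + c)) := by
      field_simp; ring
    rw [e, le_div_iff₀ (by positivity)] at h
    exact h
  -- identity: RHS - LHS = -[2(x-(1-c²))² + (3-5c)(1+c)(x-(1-c²)) - (1+c)(1-c²-c³)]
  have hprod : 0 ≤ (5 * c - 3) * (1 + c) * (1 - c ^ 2 - x) := by
    apply mul_nonneg (mul_nonneg (by linarith) h2.le) (by linarith)
  nlinarith [sq_nonneg (x - (1 - c ^ 2))]

end Summit.Ventures.DiscreteObjects.Mahler
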